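import Literature.NumberTheory.Automorphic.UnitaryGroupOrbitalMeasureOfLocalQuotient
import Literature.MeasureTheory.Group.OrbitalMeasureOfProdQuotient
import HarnessLib

/-!
# `U(H)`'s ADELIC orbital measure built from local quotient measures IS `dg ∕ dt` on `U(H)(𝔸_{L⁺}) ⧸ C(g)` (Weil constant ONE)
(Rogawski (1990) §4.3 p. 44, §5.4 p. 72: `dg = dg_∞ ⊗ ⊗_v dg_v`, `dt = dt_∞ ⊗ ⊗_v dt_v`; Gelbart (1975) p. 155 (10.19))

Topic `NumberTheory/Automorphic`; THEOREMS ONLY.  The `∞ × f` step (★ `orbitalMeasureOfProd_quotientMeasure_eq_quotientMeasure`) on top of the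
finite-adelic identification ★ `UnitaryGroup.finAdelicOrbitalMeasureOfLocal_quotientMeasure_eq`, along ★ `adelicProdEquiv`:

* **`UnitaryGroup.adelicOrbitalMeasureOfLocal_quotientMeasure_eq`** — `adelicOrbitalMeasureOfLocal L N H g (ν_∞ ∕ t_∞) (v ↦ ν_v ∕ t_v) S₀ =
  quotientMeasure C(g) t_𝔸 ν_𝔸` for the product ∕ restricted-product Haar measures `ν_𝔸`, `t_𝔸` (EXPRESSIONS supplied with their equations).

## References
* J. D. Rogawski, *Automorphic Representations of Unitary Groups in Three Variables* (1990), §4.3 p. 44, §5.4 p. 72 [Rogawski1990].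
* S. Gelbart, *Automorphic forms on adele groups* (1975), p. 155 (10.19) [Gelbart1975].
-/

set_option autoImplicit false

noncomputable section

open _root_.MeasureTheory _root_.MeasureTheory.Measure Set Filter Function NumberField IsDedekindDomain
open _root_.Topology
open Literature.Topology.RestrictedProduct Literature.Topology.Algebra.RestrictedProduct Literature.MeasureTheory.Group
open Literature.MeasureTheory.RestrictedProduct
open scoped RestrictedProduct ENNReal NNReal Pointwise

namespace Literature.NumberTheory.Automorphic

namespace UnitaryGroup

variable (L : Type) [Field L] [NumberField L] [IsCMField L] (N : ℕ) (H : Matrix (Fin N) (Fin N) L)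

section Adelic

variable (g : (cmDatum L N H).Adelic)
  [∀ v, MeasurableSpace ((cmDatum L N H).Local v)] [∀ v, BorelSpace ((cmDatum L N H).Local v)]
  -- everything of §2 …
  [∀ v, MeasurableSpace ((cmDatum L N H).Local v ⧸ Subgroup.centralizer ({((cmDatum L N H).toLocal v g)} : Set ((cmDatum L N H).Local v)))]
  [∀ v, BorelSpace ((cmDatum L N H).Local v ⧸ Subgroup.centralizer ({((cmDatum L N H).toLocal v g)} : Set ((cmDatum L N H).Local v)))]
  [MeasurableSpace (finAdelic (↥(maximalRealSubfield L)) L (IsCMField.complexConj L) N H ⧸ Subgroup.centralizer ({(finPart (↥(maximalRealSubfield L)) L (IsCMField.complexConj L) N H g)} : Set (finAdelic (↥(maximalRealSubfield L)) L (IsCMField.complexConj L) N H)))]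
  [BorelSpace (finAdelic (↥(maximalRealSubfield L)) L (IsCMField.complexConj L) N H ⧸ Subgroup.centralizer ({(finPart (↥(maximalRealSubfield L)) L (IsCMField.complexConj L) N H g)} : Set (finAdelic (↥(maximalRealSubfield L)) L (IsCMField.complexConj L) N H)))]
  [∀ v, MeasurableSpace (↥(localPi L (IsCMField.complexConj L) N H v))] [∀ v, BorelSpace (↥(localPi L (IsCMField.complexConj L) N H v))]
  [∀ v, LocallyCompactSpace (↥(localPi L (IsCMField.complexConj L) N H v))] [∀ v, SecondCountableTopology (↥(localPi L (IsCMField.complexConj L) N H v))]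
  [BorelSpace (Πʳ v : HeightOneSpectrum (𝓞 ↥(maximalRealSubfield L)), [↥(localPi L (IsCMField.complexConj L) N H v), localInt L (IsCMField.complexConj L) N H v])]
  [SecondCountableTopology (Πʳ v : HeightOneSpectrum (𝓞 ↥(maximalRealSubfield L)), [↥(localPi L (IsCMField.complexConj L) N H v), localInt L (IsCMField.complexConj L) N H v])]
  [∀ v, MeasurableSpace (↥(localPi L (IsCMField.complexConj L) N H v) ⧸ Subgroup.centralizer
    ({finAdelicEquiv (↥(maximalRealSubfield L)) L (IsCMField.complexConj L) N H (finPart (↥(maximalRealSubfield L)) L (IsCMField.complexConj L) N H g) v} : Set ↥(localPi L (IsCMField.complexConj L) N H v)))]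
  [∀ v, BorelSpace (↥(localPi L (IsCMField.complexConj L) N H v) ⧸ Subgroup.centralizer
    ({finAdelicEquiv (↥(maximalRealSubfield L)) L (IsCMField.complexConj L) N H (finPart (↥(maximalRealSubfield L)) L (IsCMField.complexConj L) N H g) v} : Set ↥(localPi L (IsCMField.complexConj L) N H v)))]
  [MeasurableSpace ((Πʳ v : HeightOneSpectrum (𝓞 ↥(maximalRealSubfield L)), [↥(localPi L (IsCMField.complexConj L) N H v), localInt L (IsCMField.complexConj L) N H v]) ⧸
    Subgroup.centralizer ({finAdelicEquiv (↥(maximalRealSubfield L)) L (IsCMField.complexConj L) N H (finPart (↥(maximalRealSubfield L)) L (IsCMField.complexConj L) N H g)} :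
      Set (Πʳ v : HeightOneSpectrum (𝓞 ↥(maximalRealSubfield L)), [↥(localPi L (IsCMField.complexConj L) N H v), localInt L (IsCMField.complexConj L) N H v])))]
  [BorelSpace ((Πʳ v : HeightOneSpectrum (𝓞 ↥(maximalRealSubfield L)), [↥(localPi L (IsCMField.complexConj L) N H v), localInt L (IsCMField.complexConj L) N H v]) ⧸
    Subgroup.centralizer ({finAdelicEquiv (↥(maximalRealSubfield L)) L (IsCMField.complexConj L) N H (finPart (↥(maximalRealSubfield L)) L (IsCMField.complexConj L) N H g)} :
      Set (Πʳ v : HeightOneSpectrum (𝓞 ↥(maximalRealSubfield L)), [↥(localPi L (IsCMField.complexConj L) N H v), localInt L (IsCMField.complexConj L) N H v])))]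
  [MeasurableSpace ((Πʳ v : HeightOneSpectrum (𝓞 ↥(maximalRealSubfield L)), [↥(localPi L (IsCMField.complexConj L) N H v), localInt L (IsCMField.complexConj L) N H v]) ⧸
    (cutout (fun v => localInt L (IsCMField.complexConj L) N H v) (fun v => Subgroup.centralizer
      ({finAdelicEquiv (↥(maximalRealSubfield L)) L (IsCMField.complexConj L) N H (finPart (↥(maximalRealSubfield L)) L (IsCMField.complexConj L) N H g) v} : Set ↥(localPi L (IsCMField.complexConj L) N H v))) : Subgroup _))]
  [BorelSpace ((Πʳ v : HeightOneSpectrum (𝓞 ↥(maximalRealSubfield L)), [↥(localPi L (IsCMField.complexConj L) N H v), localInt L (IsCMField.complexConj L) N H v]) ⧸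
    (cutout (fun v => localInt L (IsCMField.complexConj L) N H v) (fun v => Subgroup.centralizer
      ({finAdelicEquiv (↥(maximalRealSubfield L)) L (IsCMField.complexConj L) N H (finPart (↥(maximalRealSubfield L)) L (IsCMField.complexConj L) N H g) v} : Set ↥(localPi L (IsCMField.complexConj L) N H v))) : Subgroup _))]
  [MeasurableSpace (finAdelic (↥(maximalRealSubfield L)) L (IsCMField.complexConj L) N H)] [BorelSpace (finAdelic (↥(maximalRealSubfield L)) L (IsCMField.complexConj L) N H)] [LocallyCompactSpace (finAdelic (↥(maximalRealSubfield L)) L (IsCMField.complexConj L) N H)] [SecondCountableTopology (finAdelic (↥(maximalRealSubfield L)) L (IsCMField.complexConj L) N H)] [T2Space (finAdelic (↥(maximalRealSubfield L)) L (IsCMField.complexConj L) N H)]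
  [hKc : ∀ v, CompactSpace (localInt L (IsCMField.complexConj L) N H v)]
  [hCP : ∀ v, IsClosed ((Subgroup.centralizer ({finAdelicEquiv (↥(maximalRealSubfield L)) L (IsCMField.complexConj L) N H (finPart (↥(maximalRealSubfield L)) L (IsCMField.complexConj L) N H g) v} : Set ↥(localPi L (IsCMField.complexConj L) N H v))) : Set ↥(localPi L (IsCMField.complexConj L) N H v))]
  [hCL : ∀ v, IsClosed ((Subgroup.centralizer ({((cmDatum L N H).toLocal v g)} : Set ((cmDatum L N H).Local v))) : Set ((cmDatum L N H).Local v))]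
  (ν : ∀ v, Measure ((cmDatum L N H).Local v)) [∀ v, IsHaarMeasure (ν v)] [∀ v, (ν v).IsMulRightInvariant]
  (t : ∀ v, Measure (Subgroup.centralizer ({((cmDatum L N H).toLocal v g)} : Set ((cmDatum L N H).Local v))))
  [∀ v, IsHaarMeasure (t v)] [∀ v, (t v).IsInvInvariant]
  (S₀ : Finset (HeightOneSpectrum (𝓞 ↥(maximalRealSubfield L))))
  (νrp : Measure (Πʳ v : HeightOneSpectrum (𝓞 ↥(maximalRealSubfield L)), [↥(localPi L (IsCMField.complexConj L) N H v), localInt L (IsCMField.complexConj L) N H v]))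
  [IsHaarMeasure νrp] [νrp.IsMulRightInvariant]
  (ρ : Measure (cutout (fun v => localInt L (IsCMField.complexConj L) N H v) (fun v => Subgroup.centralizer
      ({finAdelicEquiv (↥(maximalRealSubfield L)) L (IsCMField.complexConj L) N H (finPart (↥(maximalRealSubfield L)) L (IsCMField.complexConj L) N H g) v} : Set ↥(localPi L (IsCMField.complexConj L) N H v))) : Subgroup (Πʳ v : HeightOneSpectrum (𝓞 ↥(maximalRealSubfield L)),
          [↥(localPi L (IsCMField.complexConj L) N H v), localInt L (IsCMField.complexConj L) N H v])))
  [ρ.IsMulLeftInvariant] [IsFiniteMeasureOnCompacts ρ] [ρ.IsOpenPosMeasure] [ρ.IsInvInvariant] [SFinite ρ]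
  (ρM : Measure (Subgroup.centralizer ({finAdelicEquiv (↥(maximalRealSubfield L)) L (IsCMField.complexConj L) N H (finPart (↥(maximalRealSubfield L)) L (IsCMField.complexConj L) N H g)} :
      Set (Πʳ v : HeightOneSpectrum (𝓞 ↥(maximalRealSubfield L)), [↥(localPi L (IsCMField.complexConj L) N H v), localInt L (IsCMField.complexConj L) N H v]))))
  [ρM.IsMulLeftInvariant] [IsFiniteMeasureOnCompacts ρM] [ρM.IsOpenPosMeasure] [ρM.IsInvInvariant] [SFinite ρM]
  (νf : Measure (finAdelic (↥(maximalRealSubfield L)) L (IsCMField.complexConj L) N H)) [IsHaarMeasure νf] [νf.IsMulRightInvariant]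
  (tf : Measure (Subgroup.centralizer ({(finPart (↥(maximalRealSubfield L)) L (IsCMField.complexConj L) N H g)} : Set (finAdelic (↥(maximalRealSubfield L)) L (IsCMField.complexConj L) N H))))
  [tf.IsMulLeftInvariant] [IsFiniteMeasureOnCompacts tf] [tf.IsOpenPosMeasure] [tf.IsInvInvariant] [SFinite tf]
  -- … plus the archimedean and global structures
  [MeasurableSpace ((cmDatum L N H).Adelic ⧸ Subgroup.centralizer ({g} : Set (cmDatum L N H).Adelic))] [BorelSpace ((cmDatum L N H).Adelic ⧸ Subgroup.centralizer ({g} : Set (cmDatum L N H).Adelic))]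
  [MeasurableSpace (arch (↥(maximalRealSubfield L)) L (IsCMField.complexConj L) N H ⧸ Subgroup.centralizer ({archPart (↥(maximalRealSubfield L)) L (IsCMField.complexConj L) N H g} : Set (arch (↥(maximalRealSubfield L)) L (IsCMField.complexConj L) N H)))]
  [BorelSpace (arch (↥(maximalRealSubfield L)) L (IsCMField.complexConj L) N H ⧸ Subgroup.centralizer ({archPart (↥(maximalRealSubfield L)) L (IsCMField.complexConj L) N H g} : Set (arch (↥(maximalRealSubfield L)) L (IsCMField.complexConj L) N H)))]
  [MeasurableSpace (cmDatum L N H).Adelic] [BorelSpace (cmDatum L N H).Adelic] [MeasurableSpace (arch (↥(maximalRealSubfield L)) L (IsCMField.complexConj L) N H)] [BorelSpace (arch (↥(maximalRealSubfield L)) L (IsCMField.complexConj L) N H)]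
  [LocallyCompactSpace (arch (↥(maximalRealSubfield L)) L (IsCMField.complexConj L) N H)] [SecondCountableTopology (arch (↥(maximalRealSubfield L)) L (IsCMField.complexConj L) N H)] [T2Space (arch (↥(maximalRealSubfield L)) L (IsCMField.complexConj L) N H)]
  [LocallyCompactSpace (cmDatum L N H).Adelic] [SecondCountableTopology (cmDatum L N H).Adelic] [T2Space (cmDatum L N H).Adelic]

set_option maxHeartbeats 1600000 in
set_option synthInstance.maxHeartbeats 400000 in
-- HB: the concrete `cmDatum` ∕ restricted-product carrier types are expensive to unify (statement elaboration; the proof is two rewrites)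
/-- **`ofLocal (dg_∞ ∕ dt_∞, dg_v ∕ dt_v) = dg ∕ dt` on `U(H)(𝔸_{L⁺}) ⧸ C(g)`, Weil constant ONE** — the (O10-b3) identification: ★
`adelicOrbitalMeasureOfLocal L N H g (ν_∞ ∕ t_∞) (v ↦ ν_v ∕ t_v) S₀ = quotientMeasure C(g) t_𝔸 ν_𝔸` for the product ∕ restricted-product Haar measures
`ν_𝔸 = adelicProdEquiv⁻¹_* (ν_∞ ⊗ ν_f)`, `t_𝔸 = (adelicProdEquiv⁻¹|)_* (t_∞ ⊗ t_f)` with `ν_f`, `t_f` as in ★ `finAdelicOrbitalMeasureOfLocal_quotientMeasure_eq` (model-side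
data and normalisations, and all global measures as EXPRESSIONS with their equations, are hypotheses). [cite: Rogawski1990, §5.4 p. 72] -/
theorem adelicOrbitalMeasureOfLocal_quotientMeasure_eq
    [hCi : IsClosed ((Subgroup.centralizer ({archPart (↥(maximalRealSubfield L)) L (IsCMField.complexConj L) N H g} : Set (arch (↥(maximalRealSubfield L)) L (IsCMField.complexConj L) N H))) : Set (arch (↥(maximalRealSubfield L)) L (IsCMField.complexConj L) N H))]
    [hCf : IsClosed ((Subgroup.centralizer ({(finPart (↥(maximalRealSubfield L)) L (IsCMField.complexConj L) N H g)} : Set (finAdelic (↥(maximalRealSubfield L)) L (IsCMField.complexConj L) N H))) : Set (finAdelic (↥(maximalRealSubfield L)) L (IsCMField.complexConj L) N H))]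
    (νi : Measure (arch (↥(maximalRealSubfield L)) L (IsCMField.complexConj L) N H)) [IsHaarMeasure νi] [νi.IsMulRightInvariant]
    (ti : Measure (Subgroup.centralizer ({archPart (↥(maximalRealSubfield L)) L (IsCMField.complexConj L) N H g} : Set (arch (↥(maximalRealSubfield L)) L (IsCMField.complexConj L) N H))))
    [ti.IsMulLeftInvariant] [IsFiniteMeasureOnCompacts ti] [ti.IsOpenPosMeasure] [ti.IsInvInvariant] [SFinite ti]
    (tP : Measure ((Subgroup.centralizer ({archPart (↥(maximalRealSubfield L)) L (IsCMField.complexConj L) N H g} : Set (arch (↥(maximalRealSubfield L)) L (IsCMField.complexConj L) N H))).prod (Subgroup.centralizer ({(finPart (↥(maximalRealSubfield L)) L (IsCMField.complexConj L) N H g)} : Set (finAdelic (↥(maximalRealSubfield L)) L (IsCMField.complexConj L) N H)))))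
    [tP.IsMulLeftInvariant] [IsFiniteMeasureOnCompacts tP] [tP.IsOpenPosMeasure] [tP.IsInvInvariant] [SFinite tP]
    (tA : Measure (Subgroup.centralizer ({g} : Set (cmDatum L N H).Adelic))) [tA.IsMulLeftInvariant] [IsFiniteMeasureOnCompacts tA] [tA.IsOpenPosMeasure]
    [tA.IsInvInvariant] [SFinite tA]
    (νA : Measure (cmDatum L N H).Adelic) [IsHaarMeasure νA] [νA.IsMulRightInvariant]
    (hCA : IsClosed ((Subgroup.centralizer ({g} : Set (cmDatum L N H).Adelic)) : Set (cmDatum L N H).Adelic))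
    (ψ : ∀ v, ↥(localPi L (IsCMField.complexConj L) N H v) ≃ₜ* (cmDatum L N H).Local v) (hψ : ψ = fun v => localPiEquiv L (IsCMField.complexConj L) N H v)
    (hC : ∀ v, ∀ x : (cmDatum L N H).Local v, (ψ v).symm.toMulEquiv x ∈ Subgroup.centralizer ({finAdelicEquiv (↥(maximalRealSubfield L)) L (IsCMField.complexConj L) N H (finPart (↥(maximalRealSubfield L)) L (IsCMField.complexConj L) N H g) v} : Set ↥(localPi L (IsCMField.complexConj L) N H v)) ↔ x ∈ Subgroup.centralizer ({((cmDatum L N H).toLocal v g)} : Set ((cmDatum L N H).Local v)))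
    (hCrp : ∀ x : (Πʳ v : HeightOneSpectrum (𝓞 ↥(maximalRealSubfield L)), [↥(localPi L (IsCMField.complexConj L) N H v), localInt L (IsCMField.complexConj L) N H v]), (finAdelicEquiv (↥(maximalRealSubfield L)) L (IsCMField.complexConj L) N H).symm.toMulEquiv x ∈ Subgroup.centralizer ({(finPart (↥(maximalRealSubfield L)) L (IsCMField.complexConj L) N H g)} : Set (finAdelic (↥(maximalRealSubfield L)) L (IsCMField.complexConj L) N H)) ↔ x ∈ Subgroup.centralizer ({finAdelicEquiv (↥(maximalRealSubfield L)) L (IsCMField.complexConj L) N H (finPart (↥(maximalRealSubfield L)) L (IsCMField.complexConj L) N H g)} : Set (Πʳ v : HeightOneSpectrum (𝓞 ↥(maximalRealSubfield L)), [↥(localPi L (IsCMField.complexConj L) N H v), localInt L (IsCMField.complexConj L) N H v])))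
    (ν' : ∀ v, Measure ↥(localPi L (IsCMField.complexConj L) N H v)) [∀ v, IsHaarMeasure (ν' v)] [∀ v, (ν' v).IsMulRightInvariant]
    (t' : ∀ v, Measure (Subgroup.centralizer ({finAdelicEquiv (↥(maximalRealSubfield L)) L (IsCMField.complexConj L) N H (finPart (↥(maximalRealSubfield L)) L (IsCMField.complexConj L) N H g) v} : Set ↥(localPi L (IsCMField.complexConj L) N H v)))) [∀ v, (t' v).IsMulLeftInvariant] [∀ v, IsFiniteMeasureOnCompacts (t' v)]
    [∀ v, (t' v).IsOpenPosMeasure] [∀ v, (t' v).IsInvInvariant] [∀ v, SFinite (t' v)] [∀ v, SigmaFinite (t' v)]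
    (hm : ∀ v, Measure.map (cosetCongr (ψ v).symm.toMulEquiv (Subgroup.centralizer ({((cmDatum L N H).toLocal v g)} : Set ((cmDatum L N H).Local v))) (Subgroup.centralizer ({finAdelicEquiv (↥(maximalRealSubfield L)) L (IsCMField.complexConj L) N H (finPart (↥(maximalRealSubfield L)) L (IsCMField.complexConj L) N H g) v} : Set ↥(localPi L (IsCMField.complexConj L) N H v))) (hC v))
      (quotientMeasure (Subgroup.centralizer ({((cmDatum L N H).toLocal v g)} : Set ((cmDatum L N H).Local v))) (t v) (hCL v) (ν v)) = quotientMeasure (Subgroup.centralizer ({finAdelicEquiv (↥(maximalRealSubfield L)) L (IsCMField.complexConj L) N H (finPart (↥(maximalRealSubfield L)) L (IsCMField.complexConj L) N H g) v} : Set ↥(localPi L (IsCMField.complexConj L) N H v))) (t' v) (hCP v) (ν' v))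
    (hν1 : ∀ v, v ∉ S₀ → ν' v (localInt L (IsCMField.complexConj L) N H v : Set ↥(localPi L (IsCMField.complexConj L) N H v)) = 1)
    (ht1 : ∀ v, v ∉ S₀ → t' v ((inH (fun v => localInt L (IsCMField.complexConj L) N H v) (fun v => Subgroup.centralizer ({finAdelicEquiv (↥(maximalRealSubfield L)) L (IsCMField.complexConj L) N H (finPart (↥(maximalRealSubfield L)) L (IsCMField.complexConj L) N H g) v} : Set ↥(localPi L (IsCMField.complexConj L) N H v))) v : Subgroup (Subgroup.centralizer ({finAdelicEquiv (↥(maximalRealSubfield L)) L (IsCMField.complexConj L) N H (finPart (↥(maximalRealSubfield L)) L (IsCMField.complexConj L) N H g) v} : Set ↥(localPi L (IsCMField.complexConj L) N H v)))) : Set (Subgroup.centralizer ({finAdelicEquiv (↥(maximalRealSubfield L)) L (IsCMField.complexConj L) N H (finPart (↥(maximalRealSubfield L)) L (IsCMField.complexConj L) N H g) v} : Set ↥(localPi L (IsCMField.complexConj L) N H v)))) = 1)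
    (hm1 : ∀ v, v ∉ S₀ → quotientMeasure (Subgroup.centralizer ({finAdelicEquiv (↥(maximalRealSubfield L)) L (IsCMField.complexConj L) N H (finPart (↥(maximalRealSubfield L)) L (IsCMField.complexConj L) N H g) v} : Set ↥(localPi L (IsCMField.complexConj L) N H v))) (t' v) (hCP v) (ν' v) (quotBase (fun v => localInt L (IsCMField.complexConj L) N H v) (fun v => Subgroup.centralizer ({finAdelicEquiv (↥(maximalRealSubfield L)) L (IsCMField.complexConj L) N H (finPart (↥(maximalRealSubfield L)) L (IsCMField.complexConj L) N H g) v} : Set ↥(localPi L (IsCMField.complexConj L) N H v))) v) = 1)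
    (hνrp : νrp = rpMeasure (fun v => (localInt L (IsCMField.complexConj L) N H v : Set ↥(localPi L (IsCMField.complexConj L) N H v))) ν' S₀)
    (hρ : ρ = Measure.map (cutoutEquiv (fun v => localInt L (IsCMField.complexConj L) N H v) (fun v => Subgroup.centralizer ({finAdelicEquiv (↥(maximalRealSubfield L)) L (IsCMField.complexConj L) N H (finPart (↥(maximalRealSubfield L)) L (IsCMField.complexConj L) N H g) v} : Set ↥(localPi L (IsCMField.complexConj L) N H v))))
      (rpMeasure (fun v => ((inH (fun v => localInt L (IsCMField.complexConj L) N H v) (fun v => Subgroup.centralizer ({finAdelicEquiv (↥(maximalRealSubfield L)) L (IsCMField.complexConj L) N H (finPart (↥(maximalRealSubfield L)) L (IsCMField.complexConj L) N H g) v} : Set ↥(localPi L (IsCMField.complexConj L) N H v))) v : Subgroup (Subgroup.centralizer ({finAdelicEquiv (↥(maximalRealSubfield L)) L (IsCMField.complexConj L) N H (finPart (↥(maximalRealSubfield L)) L (IsCMField.complexConj L) N H g) v} : Set ↥(localPi L (IsCMField.complexConj L) N H v)))) : Set (Subgroup.centralizer ({finAdelicEquiv (↥(maximalRealSubfield L))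 L (IsCMField.complexConj L) N H (finPart (↥(maximalRealSubfield L)) L (IsCMField.complexConj L) N H g) v} : Set ↥(localPi L (IsCMField.complexConj L) N H v))))) t' S₀))
    (hρM : ρM = Measure.map (subgroupCongrHomeomorph (MulEquiv.refl (Πʳ v : HeightOneSpectrum (𝓞 ↥(maximalRealSubfield L)), [↥(localPi L (IsCMField.complexConj L) N H v), localInt L (IsCMField.complexConj L) N H v]))
      (cutout (fun v => localInt L (IsCMField.complexConj L) N H v) (fun v => Subgroup.centralizer ({finAdelicEquiv (↥(maximalRealSubfield L)) L (IsCMField.complexConj L) N H (finPart (↥(maximalRealSubfield L)) L (IsCMField.complexConj L) N H g) v} : Set ↥(localPi L (IsCMField.complexConj L) N H v)))) (Subgroup.centralizer ({finAdelicEquiv (↥(maximalRealSubfield L)) L (IsCMField.complexConj L) N H (finPart (↥(maximalRealSubfield L)) L (IsCMField.complexConj L) N H g)} : Set (Πʳ v : HeightOneSpectrum (𝓞 ↥(maximalRealSubfield L)), [↥(localPi L (IsCMField.complexConj L) N H v), localInt L (IsCMField.complexConj L) N H v])))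
      (forall_refl_mem_iff (fun v => localInt L (IsCMField.complexConj L) N H v) (fun v => Subgroup.centralizer ({finAdelicEquiv (↥(maximalRealSubfield L)) L (IsCMField.complexConj L) N H (finPart (↥(maximalRealSubfield L)) L (IsCMField.complexConj L) N H g) v} : Set ↥(localPi L (IsCMField.complexConj L) N H v))) _
        (mem_centralizer_singleton_iff_forall_mem (fun v => localInt L (IsCMField.complexConj L) N H v) (finAdelicEquiv (↥(maximalRealSubfield L)) L (IsCMField.complexConj L) N H (finPart (↥(maximalRealSubfield L)) L (IsCMField.complexConj L) N H g))))
      continuous_id continuous_id) ρ)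
    (hνf : νf = Measure.map (finAdelicEquiv (↥(maximalRealSubfield L)) L (IsCMField.complexConj L) N H).symm.toMulEquiv νrp)
    (htf : tf = Measure.map (subgroupCongrHomeomorph (finAdelicEquiv (↥(maximalRealSubfield L)) L (IsCMField.complexConj L) N H).symm.toMulEquiv (Subgroup.centralizer ({finAdelicEquiv (↥(maximalRealSubfield L)) L (IsCMField.complexConj L) N H (finPart (↥(maximalRealSubfield L)) L (IsCMField.complexConj L) N H g)} : Set (Πʳ v : HeightOneSpectrum (𝓞 ↥(maximalRealSubfield L)), [↥(localPi L (IsCMField.complexConj L) N H v), localInt L (IsCMField.complexConj L) N H v]))) (Subgroup.centralizer ({(finPart (↥(maximalRealSubfield L)) L (IsCMField.complexConj L) N H g)} : Set (finAdelic (↥(maximalRealSubfield L)) L (IsCMField.complexConj L) N H))) hCrp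
      (finAdelicEquiv (↥(maximalRealSubfield L)) L (IsCMField.complexConj L) N H).symm.continuous (finAdelicEquiv (↥(maximalRealSubfield L)) L (IsCMField.complexConj L) N H).continuous) ρM)
    (e : arch (↥(maximalRealSubfield L)) L (IsCMField.complexConj L) N H × finAdelic (↥(maximalRealSubfield L)) L (IsCMField.complexConj L) N H ≃* (cmDatum L N H).Adelic)
    (he' : e = (adelicProdEquiv (↥(maximalRealSubfield L)) L (IsCMField.complexConj L) N H).symm.toMulEquiv) (he : Continuous e) (hes : Continuous e.symm)
    (hg : e (archPart (↥(maximalRealSubfield L)) L (IsCMField.complexConj L) N H g, finPart (↥(maximalRealSubfield L)) L (IsCMField.complexConj L) N H g) = g)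
    (hνA : νA = Measure.map e (νi.prod νf))
    (htP : Measure.map (Subgroup.prodEquiv (Subgroup.centralizer ({archPart (↥(maximalRealSubfield L)) L (IsCMField.complexConj L) N H g} : Set (arch (↥(maximalRealSubfield L)) L (IsCMField.complexConj L) N H))) (Subgroup.centralizer ({(finPart (↥(maximalRealSubfield L)) L (IsCMField.complexConj L) N H g)} : Set (finAdelic (↥(maximalRealSubfield L)) L (IsCMField.complexConj L) N H)))) tP = ti.prod tf)
    (htA : tA = Measure.map (subgroupCongrHomeomorph e ((Subgroup.centralizer ({archPart (↥(maximalRealSubfield L)) L (IsCMField.complexConj L) N H g} : Set (arch (↥(maximalRealSubfield L)) L (IsCMField.complexConj L) N H))).prod (Subgroup.centralizer ({(finPart (↥(maximalRealSubfield L)) L (IsCMField.complexConj L) N H g)} : Set (finAdelic (↥(maximalRealSubfield L)) L (IsCMField.complexConj L) N H))))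
      (Subgroup.centralizer ({g} : Set (cmDatum L N H).Adelic)) (forall_apply_mem_centralizer_iff e hg) he hes) tP) :
    adelicOrbitalMeasureOfLocal L N H g (quotientMeasure (Subgroup.centralizer ({archPart (↥(maximalRealSubfield L)) L (IsCMField.complexConj L) N H g} : Set (arch (↥(maximalRealSubfield L)) L (IsCMField.complexConj L) N H))) ti hCi νi)
        (fun v => quotientMeasure (Subgroup.centralizer ({((cmDatum L N H).toLocal v g)} : Set ((cmDatum L N H).Local v))) (t v) (hCL v) (ν v)) S₀ = quotientMeasure (Subgroup.centralizer ({g} : Set (cmDatum L N H).Adelic)) tA hCA νA := by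
  have hfin := finAdelicOrbitalMeasureOfLocal_quotientMeasure_eq L N H g ν t S₀ νrp ρ ρM νf tf hCf ψ hψ hC hCrp ν' t' hm hν1 ht1 hm1
    hνrp hρ hρM hνf htf
  have hdef : adelicOrbitalMeasureOfLocal L N H g (quotientMeasure (Subgroup.centralizer ({archPart (↥(maximalRealSubfield L)) L (IsCMField.complexConj L) N H g} : Set (arch (↥(maximalRealSubfield L)) L (IsCMField.complexConj L) N H))) ti hCi νi)
      (fun v => quotientMeasure (Subgroup.centralizer ({((cmDatum L N H).toLocal v g)} : Set ((cmDatum L N H).Local v))) (t v) (hCL v) (ν v)) S₀ =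
      orbitalMeasureOfProd (G := (cmDatum L N H).Adelic) e hg
        (quotientMeasure (Subgroup.centralizer ({archPart (↥(maximalRealSubfield L)) L (IsCMField.complexConj L) N H g} : Set (arch (↥(maximalRealSubfield L)) L (IsCMField.complexConj L) N H))) ti hCi νi)
        (finAdelicOrbitalMeasureOfLocal L N H g (fun v => quotientMeasure (Subgroup.centralizer ({((cmDatum L N H).toLocal v g)} : Set ((cmDatum L N H).Local v))) (t v) (hCL v) (ν v)) S₀) := by
    subst he'
    rfl
  haveI := hCf
  have key := orbitalMeasureOfProd_quotientMeasure_eq_quotientMeasure (G := (cmDatum L N H).Adelic) e he hes hg ti tf tP tA νi νf νA hCA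
    htP htA hνA
  rw [hdef, hfin]
  exact key

end Adelic

end UnitaryGroup

end Literature.NumberTheory.Automorphic
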